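import Summits.CriticalPhenomena.PercolationContinuityZ3.Theorems.PercNearOneGluingNoHeavyLowerTailSahiTangentAllOrders
import Summits.CriticalPhenomena.PercolationContinuityZ3.Theorems.PercNearOneGluingNoHeavyLowerTailSahiTwoDimCoupling
import Literature.Combinatorics.Sahi2008.FKG

/-!
# `NoHeavyLowerTail` (crux stmt-CriticalPhenomena-4575), Sahi programme: **THE CONTRACTION / TANGENT INEQUALITY FOR EVERY FKG WEIGHT ON
# `Bool × (chain)`, AT EVERY ORDER** — `ν(top) · E_n^{ν(·|top)}(χ_{U¹}) ≤ E_n^{ν}(F_U)` (prim-sahi-p2 gen 32's order-3 theorem, all `n`)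

Support file (Sahi cell, seat `prim-sahi-p1`, generation 47; `--supports stmt-CriticalPhenomena-4575`); part 3 of the tangent files
(`…SahiTangentDisjointSlot`, `…SahiTangentAllOrders`).  Pure proofs, NO definitions, no `sorry`, standard axioms.

THE MATHEMATICS.  `…SahiTangentAllOrders` proves THEOREM A (coin products `B_p ⊗ μ`, minimal bottom slot) and the coin-product chain case;
`…SahiTangentChain` (p2 gen 32) has the order-3 case for EVERY FKG weight on `Bool × (chain)`.  Here that generality at every order: an FKG weight
`ν` on `Bool × Fin (b+1)` has stochastically increasing rows (`SahiTwoDim.cdf_cross_of_mul_le_mul`), so the row-quantile coupling of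
`…SahiTwoDimCoupling` (seat prim-sahi-p1, gen 2) writes `ν` as the push-forward of the product weight `(row masses) ⊗ w₂` on `Bool × Fin K` — a
COIN PRODUCT `B_q ⊗ w₂`, `q = ν(top)`, over the chain `Fin K` — along a monotone ROW-PRESERVING map `(ε,u) ↦ (ε, q_ε(u))`
(`exists_rowQuantile_coupling_fst`: the gen-2 proof verbatim with the form of the map recorded; `…_prod`: the grid packaged).  Pulled back
(`sahiE_pushWeight`), `F_U` is a pair family with tops `χ_{U_l¹} ∘ q_⊤` and NESTED bottoms `χ_{U_l⁰} ∘ q_⊥`, `q_⊥ ≤ q_⊤`; THEOREM A applies, and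
`E_n^{w₂}(χ_{U¹} ∘ q_⊤) = E_n^{ν(·|top)}(χ_{U¹})` because `q_⊤` pushes `w₂` to `ν(·|top)`.  Hence

  **THEOREM (`sahiE_fkg_chain_ge`; columns `Fin (b+1)`: `sahiE_fkg_chain_ge_fin`).**  `β` a finite linear order, `ν` an FKG probability
  weight on `Bool × β` with `0 < ν(top row) < 1`, `U_l⁰ ⊆ U_l¹` up-sets of `β` (`l < n`, any `n`):
  `ν(top) · E_n^{ν(·|top)}(χ_{U¹_0},…,χ_{U¹_{n−1}}) ≤ E_n^{ν}(F_0,…,F_{n−1})`,  `F_l(ε,x) = χ_{U_l^ε}(x)`.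

So `E_n ≥ P(ε=1)·E_n(·|ε=1)` holds for every increasing up-set family on `Bool × (chain)` under every FKG weight, at every order (p2 memo
FROM-prim-sahi-p2-gen32-TANGENT, Conjecture T, class 'L = chain').  HONEST LABEL: Conjecture T on general lattices `L × Bool` (non-nested bottoms; the
percolation inequality R23) remains open; nothing is asserted about `C_n`, Kahn's conjecture or the increasing star. [this work]
-/

namespace Summit.CriticalPhenomena.PercolationContinuityZ3.Theorems.SahiTangent

open Finset Function Literature.Combinatorics.Sahi2008
open scoped BigOperators

noncomputable section

/-! ### The row-quantile coupling with its first coordinate exposed -/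

section Coupling

variable {α : Type*} [LinearOrder α] [Fintype α] {b K : ℕ}

/-- **The row-quantile coupling, explicit form** — the tree's `SahiTwoDim.exists_rowQuantile_coupling` (seat prim-sahi-p1, generation 2)
re-proved VERBATIM with the conclusion strengthened to record the form of the coupling map, `(i,u) ↦ (i, q i u)` (it preserves the row and
`q` is monotone in both arguments); the original only exports `∃ G, Monotone G ∧ …`. [this work] -/
theorem exists_rowQuantile_coupling_fst (μ : α × Fin (b + 1) → ℝ) (hμ0 : ∀ p, 0 ≤ μ p) (hrow : ∀ i, 0 < (∑ j, μ (i, j)))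
    (hcross : ∀ i i' j, i ≤ i' → (∑ j', if j' ≤ j then μ (i', j') else 0) * (∑ j, μ (i, j)) ≤ (∑ j', if j' ≤ j then μ (i, j') else 0) * (∑ j, μ (i', j)))
    (γ : Fin (K + 1) → ℝ) (hγ : StrictMono γ) (hγ1 : γ (Fin.last K) = 1) (hγ0 : γ 0 = 0)
    (hC : ∀ i j, ∃ v, γ v * (∑ j, μ (i, j)) = (∑ j', if j' ≤ j then μ (i, j') else 0)) :
    ∃ q : α → Fin K → Fin (b + 1), (∀ i i' (u u' : Fin K), i ≤ i' → u ≤ u' → q i u ≤ q i' u') ∧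
      pushWeight (fun p : α × Fin K => (∑ j, μ (p.1, j)) * (γ p.2.succ - γ (Fin.castSucc p.2))) (fun p => (p.1, q p.1 p.2)) = μ := by
  classical
  have hne : ∀ i (u : Fin K), (univ.filter fun j : Fin (b + 1) => γ u.succ * (∑ j, μ (i, j)) ≤ (∑ j', if j' ≤ j then μ (i, j') else 0)).Nonempty := by
    intro i u
    refine ⟨Fin.last b, ?_⟩
    rw [mem_filter, SahiTwoDim.rowCDF_last]
    refine ⟨mem_univ _, ?_⟩
    have hle : γ u.succ ≤ 1 := by rw [← hγ1]; exact hγ.monotone (Fin.le_last _)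
    nlinarith [hrow i]
  obtain ⟨q, hq⟩ : ∃ q : α → Fin K → Fin (b + 1), ∀ i u j, q i u ≤ j ↔ γ u.succ * (∑ j, μ (i, j)) ≤ (∑ j', if j' ≤ j then μ (i, j') else 0) := by
    refine ⟨fun i u => (univ.filter fun j : Fin (b + 1) => γ u.succ * (∑ j, μ (i, j)) ≤ (∑ j', if j' ≤ j then μ (i, j') else 0)).min' (hne i u),
      fun i u j => ⟨fun h => ?_, fun h => ?_⟩⟩
    · have hmem := min'_mem _ (hne i u)
      rw [mem_filter] at hmem
      exact hmem.2.trans (SahiTwoDim.rowCDF_mono μ hμ0 i h)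
    · exact min'_le _ _ (by rw [mem_filter]; exact ⟨mem_univ _, h⟩)
  have hqmono : ∀ i i' (u u' : Fin K), i ≤ i' → u ≤ u' → q i u ≤ q i' u' := by
    intro i i' u u' hii' huu'
    rw [hq]
    have h1 : γ u'.succ * (∑ j, μ (i', j)) ≤ (∑ j', if j' ≤ (q i' u') then μ (i', j') else 0) := (hq i' u' _).1 le_rfl
    have h2 : γ u.succ ≤ γ u'.succ := hγ.monotone (Fin.succ_le_succ_iff.2 huu')
    have h3 := hcross i i' (q i' u') hii'
    have hri := hrow i
    have hri' := hrow i'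
    nlinarith [mul_le_mul_of_nonneg_right h1 hri.le, mul_le_mul_of_nonneg_right h2 hri.le]
  refine ⟨q, hqmono, ?_⟩
  have hcum : ∀ i j, (∑ j, μ (i, j)) * ∑ u ∈ univ.filter (fun u : Fin K => q i u ≤ j),
      (γ u.succ - γ (Fin.castSucc u)) = (∑ j', if j' ≤ j then μ (i, j') else 0) := by
    intro i j
    obtain ⟨v, hv⟩ := hC i j
    have hset : univ.filter (fun u : Fin K => q i u ≤ j) = univ.filter (fun u : Fin K => (u : ℕ) < v) := by
      ext u
      simp only [mem_filter, mem_univ, true_and, hq, ← hv]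
      rw [mul_le_mul_iff_of_pos_right (hrow i), hγ.le_iff_le, Fin.le_def, Fin.val_succ]
      omega
    rw [hset, SahiTwoDim.sum_gaps γ v (by omega), hγ0, sub_zero]
    have : (⟨(v : ℕ), by omega⟩ : Fin (K + 1)) = v := Fin.ext rfl
    rw [this, mul_comm, hv]
  have hfib : ∀ i j, (∑ j, μ (i, j)) * ∑ u ∈ univ.filter (fun u : Fin K => q i u = j),
      (γ u.succ - γ (Fin.castSucc u)) = μ (i, j) := by
    intro i j
    induction j using Fin.cases with
    | zero =>
      have hset : univ.filter (fun u : Fin K => q i u = 0) = univ.filter (fun u : Fin K => q i u ≤ 0) := by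
        ext u; simp
      rw [hset, hcum, SahiTwoDim.rowCDF_zero]
    | succ j' =>
      have hset : univ.filter (fun u : Fin K => q i u ≤ j'.succ) =
          univ.filter (fun u : Fin K => q i u ≤ Fin.castSucc j') ∪ univ.filter (fun u : Fin K => q i u = j'.succ) := by
        ext u
        simp only [mem_filter, mem_univ, true_and, mem_union]
        constructor
        · intro h
          rcases lt_or_eq_of_le h with h | h
          · exact Or.inl (Fin.le_castSucc_iff.2 h)
          · exact Or.inr h
        · rintro (h | h)
          · exact h.trans (Fin.castSucc_le_succ j')
          · exact h.le
      have hdisj : Disjoint (univ.filter (fun u : Fin K => q i u ≤ Fin.castSucc j'))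
          (univ.filter (fun u : Fin K => q i u = j'.succ)) := by
        rw [disjoint_filter]
        intro u _ h1 h2
        rw [h2] at h1
        exact absurd h1 (not_le.2 Fin.castSucc_lt_succ)
      have h := hcum i j'.succ
      rw [hset, sum_union hdisj, mul_add, hcum, SahiTwoDim.rowCDF_succ] at h
      linarith
  funext ⟨i, j⟩
  rw [pushWeight_apply, Fintype.sum_prod_type, Finset.sum_eq_single i]
  · rw [← hfib i j, mul_sum, ← sum_filter]
    refine sum_congr ?_ fun u _ => rfl
    ext u
    simp
  · intro i' _ hi'
    refine sum_eq_zero fun u _ => ?_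
    rw [if_neg]
    intro h
    exact hi' (Prod.mk.inj h).1
  · exact fun h => (h (mem_univ _)).elim

/-- **Packaged coupling**: a nonnegative weight on `α × Fin (b+1)` with positive row masses and stochastically increasing rows is the push-forward
of a ROW-PRESERVING monotone map `(i,u) ↦ (i, q i u)` from the product weight `(row mass) ⊗ w₂` on `α × Fin K`, `w₂` a probability weight on
the chain `Fin K` (the grid construction of `SahiTwoDim.sahiPositive_of_cdf_cross`, packaged). [this work] -/
theorem exists_rowQuantile_coupling_prod [Nonempty α] (μ : α × Fin (b + 1) → ℝ) (hμ0 : ∀ p, 0 ≤ μ p)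
    (hrow : ∀ i, 0 < (∑ j, μ (i, j)))
    (hcross : ∀ i i' j, i ≤ i' → (∑ j', if j' ≤ j then μ (i', j') else 0) * (∑ j, μ (i, j)) ≤
      (∑ j', if j' ≤ j then μ (i, j') else 0) * (∑ j, μ (i', j))) :
    ∃ (K : ℕ) (w₂ : Fin K → ℝ), (∀ u, 0 ≤ w₂ u) ∧ (∑ u, w₂ u = 1) ∧
      ∃ q : α → Fin K → Fin (b + 1), (∀ i i' (u u' : Fin K), i ≤ i' → u ≤ u' → q i u ≤ q i' u') ∧
        pushWeight (fun p : α × Fin K => (∑ j, μ (p.1, j)) * w₂ p.2) (fun p => (p.1, q p.1 p.2)) = μ := by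
  classical
  obtain ⟨C, hC⟩ : ∃ C : Finset ℝ, C = insert 0 (univ.image fun p : α × Fin (b + 1) =>
      (∑ j', if j' ≤ p.2 then μ (p.1, j') else 0) / (∑ j, μ (p.1, j))) := ⟨_, rfl⟩
  have h0C : (0 : ℝ) ∈ C := by rw [hC]; exact mem_insert_self _ _
  have hmemC : ∀ i j, (∑ j', if j' ≤ j then μ (i, j') else 0) / (∑ j, μ (i, j)) ∈ C := fun i j => by
    rw [hC]; exact mem_insert_of_mem (mem_image_of_mem _ (mem_univ (i, j)))
  obtain ⟨i₀⟩ := ‹Nonempty α›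
  have h1C : (1 : ℝ) ∈ C := by
    have h := hmemC i₀ (Fin.last b)
    rwa [SahiTwoDim.rowCDF_last, div_self (hrow i₀).ne'] at h
  have hCbounds : ∀ c ∈ C, 0 ≤ c ∧ c ≤ 1 := by
    intro c hc
    rw [hC, mem_insert, mem_image] at hc
    rcases hc with rfl | ⟨p, _, rfl⟩
    · exact ⟨le_rfl, zero_le_one⟩
    · exact ⟨div_nonneg (SahiTwoDim.rowCDF_nonneg μ hμ0 _ _) (hrow _).le,
        (div_le_one (hrow _)).2 (SahiTwoDim.rowCDF_le_rowMass μ hμ0 _ _)⟩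
  have hcard : 2 ≤ C.card := by
    have : ({0, 1} : Finset ℝ) ⊆ C := by
      intro c hc
      simp only [mem_insert, mem_singleton] at hc
      rcases hc with rfl | rfl
      · exact h0C
      · exact h1C
    calc 2 = ({0, 1} : Finset ℝ).card := by rw [card_pair zero_ne_one]
      _ ≤ C.card := card_le_card this
  obtain ⟨K, hK⟩ : ∃ K, C.card = K + 1 := Nat.exists_eq_succ_of_ne_zero (by omega)
  obtain ⟨γ, hγdef⟩ : ∃ γ : Fin (K + 1) → ℝ, γ = fun v => C.orderEmbOfFin hK v := ⟨_, rfl⟩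
  have hγ : StrictMono γ := by rw [hγdef]; exact (C.orderEmbOfFin hK).strictMono
  have hγ0 : γ 0 = 0 := by
    rw [hγdef]
    show C.orderEmbOfFin hK ⟨0, by omega⟩ = 0
    rw [orderEmbOfFin_zero hK (by omega)]
    exact le_antisymm (min'_le _ _ h0C) ((hCbounds _ (min'_mem _ _)).1)
  have hγ1 : γ (Fin.last K) = 1 := by
    rw [hγdef]
    show C.orderEmbOfFin hK ⟨K, by omega⟩ = 1
    have h := orderEmbOfFin_last hK (by omega)
    simp only [Nat.add_sub_cancel] at h
    rw [h]
    exact le_antisymm ((hCbounds _ (max'_mem _ _)).2) (le_max' _ _ h1C)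
  have hCγ : ∀ i j, ∃ v, γ v * (∑ j, μ (i, j)) = (∑ j', if j' ≤ j then μ (i, j') else 0) := by
    intro i j
    have h : (∑ j', if j' ≤ j then μ (i, j') else 0) / (∑ j, μ (i, j)) ∈ Set.range (C.orderEmbOfFin hK) := by
      rw [range_orderEmbOfFin]; exact hmemC i j
    obtain ⟨v, hv⟩ := h
    refine ⟨v, ?_⟩
    rw [hγdef]
    show C.orderEmbOfFin hK v * (∑ j, μ (i, j)) = (∑ j', if j' ≤ j then μ (i, j') else 0)
    rw [hv, div_mul_cancel₀ _ (hrow i).ne']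
  obtain ⟨q, hqmono, hpush⟩ := exists_rowQuantile_coupling_fst μ hμ0 hrow hcross γ hγ hγ1 hγ0 hCγ
  exact ⟨K, fun u => γ u.succ - γ (Fin.castSucc u), fun u => sub_nonneg.2 (hγ.monotone (Fin.castSucc_le_succ u)),
    SahiTwoDim.sum_gaps_univ γ hγ0 hγ1, q, hqmono, hpush⟩

end Coupling

/-! ### FKG weights on `Bool × Fin (b+1)`: the contraction inequality at every order -/

section FKGFin

variable {b : ℕ}

/-- **Every FKG weight on `Bool × Fin (b+1)`, every order** (columns a standard chain; the general chain is `sahiE_fkg_chain_ge`):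
for an FKG probability weight `ν` on `Bool × Fin (b+1)` with `q = ν(top row) ∈ (0,1)` and up-sets `U_l⁰ ⊆ U_l¹`,
`q · E_n^{ν(·|top)}(χ_{U¹}) ≤ E_n^{ν}(F_U)`.  Proof: the row-quantile coupling writes `ν` as the push-forward of the COIN PRODUCT
`B_q ⊗ w₂` over the chain `Fin K` along a row-preserving monotone map `(ε,u) ↦ (ε, q_ε(u))`; pulled back, `F_U` is a pair family with nested
bottoms `χ_{U_l⁰} ∘ q_⊥`, so THEOREM A applies on `Bool × Fin K`, and the pulled-back tops have `E_n^{w₂}(χ_{U¹} ∘ q_⊤) = E_n^{ν(·|top)}(χ_{U¹})`.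
[this work] -/
theorem sahiE_fkg_chain_ge_fin {ν : Bool × Fin (b + 1) → ℝ} (hν : IsFKGMeasure ν)
    (hq₀ : 0 < ∑ x, ν (true, x)) (hq₁ : 0 < ∑ x, ν (false, x))
    {n : ℕ} (U₀ U₁ : Fin n → Finset (Fin (b + 1))) (hU₀ : ∀ l, IsUpperSet (U₀ l : Set (Fin (b + 1))))
    (hU₁ : ∀ l, IsUpperSet (U₁ l : Set (Fin (b + 1)))) (hsub : ∀ l, U₀ l ⊆ U₁ l) :
    (∑ x, ν (true, x)) * sahiE (fun x => ν (true, x) / ∑ y, ν (true, y)) n (fun l => setInd (U₁ l)) ≤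
      sahiE ν n (fun l (z : Bool × Fin (b + 1)) => if z.1 then setInd (U₁ l) z.2 else setInd (U₀ l) z.2) := by
  classical
  rcases Nat.eq_zero_or_pos n with hn | hn
  · subst hn
    rw [sahiE_zero, sahiE_zero, mul_zero]
  have htot : ∑ z : Bool × Fin (b + 1), ν z = 1 := hν.sum_eq_one
  rw [Fintype.sum_prod_type, Fintype.sum_bool] at htot
  set qm := ∑ x, ν (true, x) with hqm
  have hqm1 : ∑ x, ν (false, x) = 1 - qm := by linarith
  have hqm0 : 0 ≤ qm := hq₀.le
  have hqmle : qm ≤ 1 := by linarith [hq₁.le]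
  have hrow : ∀ i : Bool, 0 < ∑ j, ν (i, j) := by
    intro i; cases i
    · exact hq₁
    · exact hq₀
  have hcross : ∀ (i i' : Bool) (j : Fin (b + 1)), i ≤ i' →
      (∑ j', if j' ≤ j then ν (i', j') else 0) * (∑ j, ν (i, j)) ≤ (∑ j', if j' ≤ j then ν (i, j') else 0) * (∑ j, ν (i', j)) :=
    fun i i' j hii' => SahiTwoDim.cdf_cross_of_mul_le_mul ν hν.mul_le_mul hii' j
  obtain ⟨K, w₂, hw₂0, hw₂1, q, hqmono, hpush⟩ := exists_rowQuantile_coupling_prod ν hν.nonneg hrow hcross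
  have hW : (fun p : Bool × Fin K => (∑ j, ν (p.1, j)) * w₂ p.2) =
      fun z : Bool × Fin K => if z.1 then qm * w₂ z.2 else (1 - qm) * w₂ z.2 := by
    funext z; rcases z with ⟨c, u⟩; cases c
    · simp [hqm1]
    · simp [hqm]
  have hE : sahiE ν n (fun l (z : Bool × Fin (b + 1)) => if z.1 then setInd (U₁ l) z.2 else setInd (U₀ l) z.2) =
      sahiE (fun z : Bool × Fin K => if z.1 then qm * w₂ z.2 else (1 - qm) * w₂ z.2) n
        (fun l (z : Bool × Fin K) => if z.1 then setInd (U₁ l) (q true z.2) else setInd (U₀ l) (q false z.2)) := by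
    conv_lhs => rw [← hpush]
    rw [sahiE_pushWeight, hW]
    congr 1
    funext l z
    rcases z with ⟨c, u⟩
    cases c <;> simp
  rw [hE]
  have hne : (Finset.univ : Finset (Fin n)).Nonempty := Finset.univ_nonempty_iff.2 ⟨⟨0, hn⟩⟩
  obtain ⟨j, -, hj⟩ := Finset.exists_min_image Finset.univ (fun l => (U₀ l).card) hne
  have hminU : ∀ i, U₀ j ⊆ U₀ i := by
    intro i
    rcases (hU₀ j).total (hU₀ i) with h | h
    · exact Finset.coe_subset.1 h
    · exact (Finset.eq_of_subset_of_card_le (Finset.coe_subset.1 h) (hj i (Finset.mem_univ i))).symm.subset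
  have hq01 : ∀ u, q false u ≤ q true u := fun u => hqmono false true u u (by decide) le_rfl
  have main := sahiE_coin_ge_mul_top_of_minimal_bottom (α := Fin K) hw₂0 hqm0 hqmle
    (sahiPositive_coin_chain hw₂0 hw₂1 hqm0 hqmle) (sahiPositive_of_linearOrder hw₂0 hw₂1 n)
    (fun l u => setInd (U₀ l) (q false u)) (fun l u => setInd (U₁ l) (q true u))
    (fun l u => setInd_nonneg _ _) (fun l u => ?_) (fun l => (monotone_setInd (hU₀ l)).comp fun u u' h => hqmono false false u u' le_rfl h)
    (fun l => (monotone_setInd (hU₁ l)).comp fun u u' h => hqmono true true u u' le_rfl h) j ?_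
  · -- identify the top functional
    have htop : sahiE w₂ n (fun l u => setInd (U₁ l) (q true u)) = sahiE (fun x => ν (true, x) / qm) n (fun l => setInd (U₁ l)) := by
      have hp : pushWeight w₂ (q true) = fun x => ν (true, x) / qm := by
        funext x
        have h := congrFun hpush (true, x)
        rw [pushWeight_apply, Fintype.sum_prod_type, Fintype.sum_bool] at h
        simp only [Prod.mk.injEq, Bool.false_eq_true, false_and, if_false, Finset.sum_const_zero, add_zero, true_and,
          ← hqm] at h
        rw [pushWeight_apply, eq_div_iff hq₀.ne', Finset.sum_mul]
        rw [← h]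
        refine Finset.sum_congr rfl fun u _ => ?_
        split_ifs <;> ring
      rw [← hp, sahiE_pushWeight]
      rfl
    rw [htop] at main
    exact main
  · simp only [setInd_apply]
    by_cases h : q false u ∈ U₀ l
    · have h' : q true u ∈ U₁ l := hsub l (hU₀ l (hq01 u) h)
      rw [if_pos h, if_pos h']
    · rw [if_neg h]; split_ifs <;> norm_num
  · intro i u
    simp only [setInd_apply]
    by_cases h : q false u ∈ U₀ j
    · have h1 : q false u ∈ U₀ i := hminU i h
      have h2 : q true u ∈ U₁ i := hsub i (hU₀ i (hq01 u) h1)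
      rw [if_pos h, if_pos h1, if_pos h2]
    · rw [if_neg h, zero_mul, zero_mul]

end FKGFin

/-! ### FKG weights on `Bool × β`, `β` any finite chain: transport along `Fin (b+1) ≃o β` -/

section FKGChain

variable {β : Type*} [LinearOrder β] [Fintype β] [DecidableEq β]

/-- **THE CONTRACTION / TANGENT INEQUALITY FOR EVERY FKG WEIGHT ON `Bool × (chain)`, AT EVERY ORDER.**  For a finite linear order `β`,
an FKG probability weight `ν` on `Bool × β` (product order) with `q = ν(top row) ∈ (0,1)`, every `n`, and up-sets `U_l⁰ ⊆ U_l¹` of `β`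
(`F_l(ε,x) = χ_{U_l^ε}(x)` the indicator of a general up-set of `Bool × β`):
  `q · E_n^{ν(· | top)}(χ_{U¹_0},…,χ_{U¹_{n−1}}) ≤ E_n^{ν}(F_0,…,F_{n−1})`.
At `n = 3` this is the tree's `sahiE_three_fkg_chain_ge` (prim-sahi-p2 gen 32, proved there from fifteen polynomial certificates); here for
all `n`, from THEOREM A and the row-quantile coupling (`sahiE_fkg_chain_ge_fin`), the general chain being identified with `Fin (b+1)`.
[this work] -/
theorem sahiE_fkg_chain_ge {ν : Bool × β → ℝ} (hν : IsFKGMeasure ν)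
    (hq₀ : 0 < ∑ x, ν (true, x)) (hq₁ : 0 < ∑ x, ν (false, x))
    {n : ℕ} (U₀ U₁ : Fin n → Finset β) (hU₀ : ∀ l, IsUpperSet (U₀ l : Set β)) (hU₁ : ∀ l, IsUpperSet (U₁ l : Set β))
    (hsub : ∀ l, U₀ l ⊆ U₁ l) :
    (∑ x, ν (true, x)) * sahiE (fun x => ν (true, x) / ∑ y, ν (true, y)) n (fun l => setInd (U₁ l)) ≤
      sahiE ν n (fun l (z : Bool × β) => if z.1 then setInd (U₁ l) z.2 else setInd (U₀ l) z.2) := by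
  classical
  have hβ : Nonempty β := by
    by_contra h
    rw [not_nonempty_iff] at h
    have h0 : ∑ x, ν (true, x) = 0 := Fintype.sum_empty _
    exact hq₀.ne' h0
  obtain ⟨b, hb⟩ : ∃ b, Fintype.card β = b + 1 := Nat.exists_eq_succ_of_ne_zero Fintype.card_ne_zero
  obtain ⟨e, -⟩ : ∃ e : Fin (b + 1) ≃o β, True := ⟨Fintype.orderIsoFinOfCardEq β hb, trivial⟩
  let E : Bool × Fin (b + 1) ≃ Bool × β := (Equiv.refl Bool).prodCongr e.toEquiv
  set ν' : Bool × Fin (b + 1) → ℝ := fun p => ν (p.1, e p.2) with hν'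
  have hpushE : pushWeight ν' E = ν := by
    funext c
    rw [pushWeight_equiv]
    rcases c with ⟨a, x⟩
    show ν (a, e (e.symm x)) = ν (a, x)
    rw [OrderIso.apply_symm_apply]
  have hν'eq : pushWeight ν E.symm = ν' := by
    funext p
    rw [pushWeight_equiv, Equiv.symm_symm]
    rfl
  have hν'FKG : IsFKGMeasure ν' := by
    rw [← hν'eq]
    refine isFKGMeasure_pushWeight hν E.symm.injective (fun a c => ?_) (fun a c => ?_)
    · rcases a with ⟨a1, a2⟩; rcases c with ⟨c1, c2⟩
      show ((a1 ⊓ c1, e.symm (a2 ⊓ c2)) : Bool × Fin (b + 1)) = ((a1 ⊓ c1, e.symm a2 ⊓ e.symm c2) : Bool × Fin (b + 1))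
      rw [OrderIso.map_inf]
    · rcases a with ⟨a1, a2⟩; rcases c with ⟨c1, c2⟩
      show ((a1 ⊔ c1, e.symm (a2 ⊔ c2)) : Bool × Fin (b + 1)) = ((a1 ⊔ c1, e.symm a2 ⊔ e.symm c2) : Bool × Fin (b + 1))
      rw [OrderIso.map_sup]
  set V₀ : Fin n → Finset (Fin (b + 1)) := fun l => (U₀ l).map e.symm.toEquiv.toEmbedding with hV₀
  set V₁ : Fin n → Finset (Fin (b + 1)) := fun l => (U₁ l).map e.symm.toEquiv.toEmbedding with hV₁
  have hmem₀ : ∀ l j, j ∈ V₀ l ↔ e j ∈ U₀ l := by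
    intro l j; rw [hV₀]; dsimp only; rw [Finset.mem_map_equiv]; rfl
  have hmem₁ : ∀ l j, j ∈ V₁ l ↔ e j ∈ U₁ l := by
    intro l j; rw [hV₁]; dsimp only; rw [Finset.mem_map_equiv]; rfl
  have hV₀up : ∀ l, IsUpperSet (V₀ l : Set (Fin (b + 1))) := by
    intro l j j' hjj' hj
    rw [Finset.mem_coe, hmem₀] at hj ⊢
    exact hU₀ l (e.monotone hjj') hj
  have hV₁up : ∀ l, IsUpperSet (V₁ l : Set (Fin (b + 1))) := by
    intro l j j' hjj' hj
    rw [Finset.mem_coe, hmem₁] at hj ⊢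
    exact hU₁ l (e.monotone hjj') hj
  have hVsub : ∀ l, V₀ l ⊆ V₁ l := by
    intro l j hj
    rw [hmem₀] at hj
    rw [hmem₁]
    exact hsub l hj
  have hind₀ : ∀ l j, setInd (U₀ l) (e j) = setInd (V₀ l) j := by
    intro l j; simp only [setInd_apply, hmem₀]
  have hind₁ : ∀ l j, setInd (U₁ l) (e j) = setInd (V₁ l) j := by
    intro l j; simp only [setInd_apply, hmem₁]
  have hq₀' : (∑ j, ν' (true, j)) = ∑ x, ν (true, x) := Fintype.sum_equiv e.toEquiv _ _ (fun j => rfl)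
  have hq₁' : (∑ j, ν' (false, j)) = ∑ x, ν (false, x) := Fintype.sum_equiv e.toEquiv _ _ (fun j => rfl)
  have main := sahiE_fkg_chain_ge_fin hν'FKG (by rw [hq₀']; exact hq₀) (by rw [hq₁']; exact hq₁) V₀ V₁ hV₀up hV₁up hVsub
  rw [hq₀'] at main
  have hR : sahiE ν n (fun l (z : Bool × β) => if z.1 then setInd (U₁ l) z.2 else setInd (U₀ l) z.2) =
      sahiE ν' n (fun l (z : Bool × Fin (b + 1)) => if z.1 then setInd (V₁ l) z.2 else setInd (V₀ l) z.2) := by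
    rw [← hpushE, sahiE_pushWeight]
    congr 1
    funext l z
    rcases z with ⟨c, j⟩
    have hEz : E (c, j) = (c, e j) := rfl
    simp only [Function.comp_apply, hEz]
    cases c
    · simpa using hind₀ l j
    · simpa using hind₁ l j
  have hL : sahiE (fun x => ν (true, x) / ∑ y, ν (true, y)) n (fun l => setInd (U₁ l)) =
      sahiE (fun j => ν' (true, j) / ∑ y, ν (true, y)) n (fun l => setInd (V₁ l)) := by
    have hp : pushWeight (fun j : Fin (b + 1) => ν' (true, j) / ∑ y, ν (true, y)) e.toEquiv =
        fun x => ν (true, x) / ∑ y, ν (true, y) := by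
      funext x
      rw [pushWeight_equiv]
      show ν (true, e (e.symm x)) / _ = _
      rw [OrderIso.apply_symm_apply]
    rw [← hp, sahiE_pushWeight]
    congr 1
    funext l
    funext j
    exact hind₁ l j
  rw [hR, hL]
  exact main

end FKGChain

end

end Summit.CriticalPhenomena.PercolationContinuityZ3.Theorems.SahiTangent
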